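import Summits.AtomisticToContinuum.Crystallization.Theorems.HolmgrenBoyleLindPatchHull

/-!
# Route `HolmgrenBoyleLind`: patch-hull elements of an FLC Delone Lennard-Jones equilibrium, part 2

Support file for item stmt-AtomisticToContinuum-6079 (`FLCEquilibriumPeriodic` ⇔ crux
`HalfSpaceUniqueContinuation` granted `HalfSpaceRigidityPeriodic`). Continues
`HolmgrenBoyleLindPatchHull.lean`:

* `hbl_hull_balanced` — **hull elements of an equilibrium are equilibria**: if `Λ ⊂ ℝ³` is
  `δ`-separated and in exact Lennard-Jones force balance (`HasSum … 0` at every point), so is every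
  element `ω` of its patch-hull: at `x ∈ ω` the forces of the points within distance `R` agree with
  those at the corresponding point `x + v ∈ Λ` (the ball `B(x, R)` lies inside the `(‖x‖ + R)`-patch),
  both far fields are `≤ 2048/(δ³R⁴)` (`hbl_norm_tsum_sub_sum_le`), so the total force at `x` —
  which exists by absolute summability — has norm `≤ 4096/(δ³R⁴)` for every `R ≥ max δ 1`, i.e.
  vanishes;
* `halfSpaceUniqueContinuation_iff_explicit` — the crux is equivalent to its form in which the two
  hull elements are themselves assumed `δ`-separated, `r`-dense, FLC and balanced (the form every
  attack on `HalfSpaceUniqueContinuation` starts from).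

All `[folklore]`; nothing here closes an item.
-/

noncomputable section

namespace Summit.AtomisticToContinuum.Crystallization.Theorems

open scoped BigOperators Topology
open Literature.MathematicalPhysics.StatisticalMechanics
open Summit.AtomisticToContinuum.Crystallization.Theorems.ExcessDecayLiouville
open Summit.AtomisticToContinuum.Crystallization.Theses.HolmgrenBoyleLind

/-! ## Hull elements of an equilibrium are equilibria -/

/-- Translating both arguments leaves the pair force unchanged. [folklore] -/
theorem hbl_ljForce_add_right (x q v : (EuclideanSpace ℝ (Fin 3))) :
    (deriv lennardJones (dist (x + v) (q + v)) / dist (x + v) (q + v)) • ((x + v) - (q + v)) =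
      (deriv lennardJones (dist x q) / dist x q) • (x - q) := by
  rw [dist_add_right, add_sub_add_right_eq_sub]

/-- **Hull elements of an equilibrium are equilibria.** If `Λ ⊂ ℝ³` is `δ`-separated and in exact
Lennard-Jones force balance, so is every element `ω` of its patch-hull: at `x ∈ ω` the forces of the
points of `ω` within distance `R` equal those at the corresponding point `x + v ∈ Λ` (the ball
`B(x, R)` lies in the `(‖x‖ + R)`-patch), and both far fields are `≤ 2048/(δ³R⁴)`; so the total force
at `x`, which exists by absolute summability, has norm `≤ 4096/(δ³R⁴)` for every `R ≥ max δ 1`.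
[folklore] -/
theorem hbl_hull_balanced {Λ ω : Set (EuclideanSpace ℝ (Fin 3))} {δ : ℝ} (hδ : 0 < δ)
    (hsep : ∀ x ∈ Λ, ∀ y ∈ Λ, x ≠ y → δ ≤ dist x y)
    (hbal : ∀ x ∈ Λ, HasSum (fun y : {y : (EuclideanSpace ℝ (Fin 3)) // y ∈ Λ ∧ y ≠ x} =>
      (deriv lennardJones (dist x (y : (EuclideanSpace ℝ (Fin 3)))) / dist x (y : (EuclideanSpace ℝ (Fin 3)))) • (x - (y : (EuclideanSpace ℝ (Fin 3))))) 0)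
    (hω : ∀ R : ℝ, ∃ v : (EuclideanSpace ℝ (Fin 3)), {z : (EuclideanSpace ℝ (Fin 3)) | z ∈ ω ∧ ‖z‖ ≤ R} = {z : (EuclideanSpace ℝ (Fin 3)) | z + v ∈ Λ ∧ ‖z‖ ≤ R}) :
    ∀ x ∈ ω, HasSum (fun y : {y : (EuclideanSpace ℝ (Fin 3)) // y ∈ ω ∧ y ≠ x} =>
      (deriv lennardJones (dist x (y : (EuclideanSpace ℝ (Fin 3)))) / dist x (y : (EuclideanSpace ℝ (Fin 3)))) • (x - (y : (EuclideanSpace ℝ (Fin 3))))) 0 := by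
  classical
  intro x hx
  have hsepω := hbl_hull_separated hsep hω
  have hsumω : Summable (fun y : {y : (EuclideanSpace ℝ (Fin 3)) // y ∈ ω ∧ y ≠ x} =>
      (deriv lennardJones (dist x (y : (EuclideanSpace ℝ (Fin 3)))) / dist x (y : (EuclideanSpace ℝ (Fin 3)))) • (x - (y : (EuclideanSpace ℝ (Fin 3))))) :=
    (hbl_summable_norm_ljForce hδ hsepω hx).of_norm
  set s : (EuclideanSpace ℝ (Fin 3)) := ∑' y : {y : (EuclideanSpace ℝ (Fin 3)) // y ∈ ω ∧ y ≠ x},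
    (deriv lennardJones (dist x (y : (EuclideanSpace ℝ (Fin 3)))) / dist x (y : (EuclideanSpace ℝ (Fin 3)))) • (x - (y : (EuclideanSpace ℝ (Fin 3)))) with hs
  suffices h0 : s = 0 by
    rw [← h0]
    exact hsumω.hasSum
  -- the norm bound for every `R ≥ max δ 1`
  have hbound : ∀ R : ℝ, max δ 1 ≤ R → ‖s‖ ≤ 4096 / (δ ^ 3 * R ^ 4) := by
    intro R hR
    have hδR : δ ≤ R := (le_max_left _ _).trans hR
    have hR1 : 1 ≤ R := (le_max_right _ _).trans hR
    have hR0 : 0 ≤ R := zero_le_one.trans hR1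
    -- near finset of `ω` about `x`
    set A : Finset (EuclideanSpace ℝ (Fin 3)) := (hbl_finite_near hδ hsepω x R).toFinset.filter
      (fun q => q ≠ x ∧ dist q x < R) with hAdef
    have hA : ∀ q : (EuclideanSpace ℝ (Fin 3)), q ∈ A ↔ q ∈ ω ∧ q ≠ x ∧ dist q x < R := by
      intro q
      rw [hAdef, Finset.mem_filter, Set.Finite.mem_toFinset, Set.mem_setOf_eq]
      constructor
      · rintro ⟨⟨hq, -⟩, hqx, hqR⟩
        exact ⟨hq, hqx, hqR⟩
      · rintro ⟨hq, hqx, hqR⟩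
        exact ⟨⟨hq, hqR.le⟩, hqx, hqR⟩
    -- the corresponding point of `Λ`
    obtain ⟨v, hv⟩ := hω (‖x‖ + R)
    have hxn : ‖x‖ ≤ ‖x‖ + R := le_add_of_nonneg_right hR0
    have hxΛ := (hbl_mem_iff_of_patch_eq (T := {z : (EuclideanSpace ℝ (Fin 3)) | z + v ∈ Λ}) hv hxn).1 hx
    simp only [Set.mem_setOf_eq] at hxΛ
    -- near finset of `Λ` about `x + v`
    set A' : Finset (EuclideanSpace ℝ (Fin 3)) := A.map (Equiv.addRight v).toEmbedding with hA'def
    have hA' : ∀ q' : (EuclideanSpace ℝ (Fin 3)), q' ∈ A' ↔ q' ∈ Λ ∧ q' ≠ x + v ∧ dist q' (x + v) < R := by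
      intro q'
      rw [hA'def, Finset.mem_map]
      constructor
      · rintro ⟨q, hq, rfl⟩
        simp only [Equiv.coe_toEmbedding, Equiv.coe_addRight]
        obtain ⟨hqω, hqx, hqR⟩ := (hA q).1 hq
        have hqn : ‖q‖ ≤ ‖x‖ + R := by
          have h1 : ‖q‖ ≤ ‖q - x‖ + ‖x‖ := by
            have := norm_add_le (q - x) x
            rwa [sub_add_cancel] at this
          rw [← dist_eq_norm] at h1
          linarith
        have hqΛ := (hbl_mem_iff_of_patch_eq (T := {z : (EuclideanSpace ℝ (Fin 3)) | z + v ∈ Λ}) hv hqn).1 hqω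
        simp only [Set.mem_setOf_eq] at hqΛ
        refine ⟨hqΛ, fun h => hqx (add_right_cancel h), ?_⟩
        rwa [dist_add_right]
      · rintro ⟨hq'Λ, hq'x, hq'R⟩
        refine ⟨q' - v, ?_, ?_⟩
        · rw [hA]
          have hqn : ‖q' - v‖ ≤ ‖x‖ + R := by
            have h1 : ‖q' - v‖ ≤ ‖q' - v - x‖ + ‖x‖ := by
              have := norm_add_le (q' - v - x) x
              rwa [sub_add_cancel] at this
            have h2 : ‖q' - v - x‖ = dist q' (x + v) := by
              rw [dist_eq_norm]
              congr 1
              abel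
            rw [h2] at h1
            linarith
          have hmem : q' - v ∈ {z : (EuclideanSpace ℝ (Fin 3)) | z + v ∈ Λ} := by
            simp only [Set.mem_setOf_eq, sub_add_cancel]
            exact hq'Λ
          refine ⟨(hbl_mem_iff_of_patch_eq (T := {z : (EuclideanSpace ℝ (Fin 3)) | z + v ∈ Λ}) hv hqn).2 hmem,
            fun h => hq'x (by rw [← h, sub_add_cancel]), ?_⟩
          have h3 : dist (q' - v) x = dist q' (x + v) := by
            rw [dist_eq_norm, dist_eq_norm]
            congr 1
            abel
          rwa [h3]
        · simp only [Equiv.coe_toEmbedding, Equiv.coe_addRight, sub_add_cancel]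
    -- the two tails and the vanishing total force at `x + v`
    have h1 := hbl_norm_tsum_sub_sum_le hδ hδR hR1 hsepω hx A hA
    have h2 := hbl_norm_tsum_sub_sum_le hδ hδR hR1 hsep hxΛ A' hA'
    have hΛ0 : ∑' y : {y : (EuclideanSpace ℝ (Fin 3)) // y ∈ Λ ∧ y ≠ x + v},
        (deriv lennardJones (dist (x + v) (y : (EuclideanSpace ℝ (Fin 3)))) / dist (x + v) (y : (EuclideanSpace ℝ (Fin 3)))) •
          ((x + v) - (y : (EuclideanSpace ℝ (Fin 3)))) = 0 := (hbal (x + v) hxΛ).tsum_eq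
    have hsums : ∑ q' ∈ A', (deriv lennardJones (dist (x + v) q') / dist (x + v) q') •
        ((x + v) - q') =
        ∑ q ∈ A, (deriv lennardJones (dist x q) / dist x q) • (x - q) := by
      rw [hA'def, Finset.sum_map]
      refine Finset.sum_congr rfl fun q _ => ?_
      simp only [Equiv.coe_toEmbedding, Equiv.coe_addRight]
      exact hbl_ljForce_add_right x q v
    rw [hΛ0, hsums, zero_sub, norm_neg] at h2
    rw [← hs] at h1
    calc ‖s‖ = ‖(s - ∑ q ∈ A, (deriv lennardJones (dist x q) / dist x q) • (x - q)) +
          ∑ q ∈ A, (deriv lennardJones (dist x q) / dist x q) • (x - q)‖ := by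
          rw [sub_add_cancel]
      _ ≤ ‖s - ∑ q ∈ A, (deriv lennardJones (dist x q) / dist x q) • (x - q)‖ +
          ‖∑ q ∈ A, (deriv lennardJones (dist x q) / dist x q) • (x - q)‖ := norm_add_le _ _
      _ ≤ 2048 / (δ ^ 3 * R ^ 4) + 2048 / (δ ^ 3 * R ^ 4) := add_le_add h1 h2
      _ = 4096 / (δ ^ 3 * R ^ 4) := by ring
  -- let `R → ∞`
  by_contra hne
  have hspos : 0 < ‖s‖ := norm_pos_iff.2 hne
  have hδ3 : 0 < δ ^ 3 := by positivity
  set R : ℝ := max (max δ 1) (8192 / (δ ^ 3 * ‖s‖)) with hRdef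
  have hR : max δ 1 ≤ R := le_max_left _ _
  have hR1 : 1 ≤ R := (le_max_right δ 1).trans hR
  have hRpos : 0 < R := one_pos.trans_le hR1
  have hb := hbound R hR
  have hR4 : R ≤ R ^ 4 := le_self_pow₀ hR1 (by norm_num)
  have hle1 : 4096 / (δ ^ 3 * R ^ 4) ≤ 4096 / (δ ^ 3 * R) := by
    apply div_le_div_of_nonneg_left (by norm_num) (by positivity)
    exact mul_le_mul_of_nonneg_left hR4 hδ3.le
  have hle2 : 4096 / (δ ^ 3 * R) ≤ ‖s‖ / 2 := by
    rw [div_le_iff₀ (by positivity)]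
    have h8 : 8192 / (δ ^ 3 * ‖s‖) ≤ R := le_max_right _ _
    rw [div_le_iff₀ (by positivity)] at h8
    nlinarith
  linarith

/-! ## The crux with the hull hypotheses made explicit -/

/-- **`HalfSpaceUniqueContinuation`, explicit form.** The crux is equivalent to its version in which
the two patch-hull elements `ω, ω'` are assumed, in addition, to be themselves `δ`-separated,
`r`-dense, of finite local complexity and in exact Lennard-Jones force balance — all four transfer
from `Λ` (`hbl_hull_separated`, `hbl_hull_dense`, `hbl_hull_flc`, `hbl_hull_balanced`); the forward
direction just forgets them. [folklore] -/
theorem halfSpaceUniqueContinuation_iff_explicit :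
    HalfSpaceUniqueContinuation ↔
    (∀ (Λ : Set (EuclideanSpace ℝ (Fin 3))) (δ r : ℝ), 0 < δ → 0 < r →
      (∀ x ∈ Λ, ∀ y ∈ Λ, x ≠ y → δ ≤ dist x y) →
      (∀ c : EuclideanSpace ℝ (Fin 3), ∃ y ∈ Λ, dist y c ≤ r) →
      (∀ R : ℝ, Set.Finite {S : Set (EuclideanSpace ℝ (Fin 3)) |
        ∃ x ∈ Λ, S = {v : EuclideanSpace ℝ (Fin 3) | x + v ∈ Λ ∧ ‖v‖ ≤ R}}) →
      (∀ x ∈ Λ, HasSum (fun y : {y : EuclideanSpace ℝ (Fin 3) // y ∈ Λ ∧ y ≠ x} =>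
        (deriv lennardJones (dist x (y : EuclideanSpace ℝ (Fin 3))) /
          dist x (y : EuclideanSpace ℝ (Fin 3))) • (x - (y : EuclideanSpace ℝ (Fin 3)))) 0) →
      ∀ ω ω' : Set (EuclideanSpace ℝ (Fin 3)),
      (∀ R : ℝ, ∃ v : EuclideanSpace ℝ (Fin 3),
        {z : EuclideanSpace ℝ (Fin 3) | z ∈ ω ∧ ‖z‖ ≤ R} =
          {z : EuclideanSpace ℝ (Fin 3) | z + v ∈ Λ ∧ ‖z‖ ≤ R}) →
      (∀ R : ℝ, ∃ v : EuclideanSpace ℝ (Fin 3),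
        {z : EuclideanSpace ℝ (Fin 3) | z ∈ ω' ∧ ‖z‖ ≤ R} =
          {z : EuclideanSpace ℝ (Fin 3) | z + v ∈ Λ ∧ ‖z‖ ≤ R}) →
      (∀ x ∈ ω, ∀ y ∈ ω, x ≠ y → δ ≤ dist x y) →
      (∀ c : EuclideanSpace ℝ (Fin 3), ∃ y ∈ ω, dist y c ≤ r) →
      (∀ R : ℝ, Set.Finite {S : Set (EuclideanSpace ℝ (Fin 3)) |
        ∃ x ∈ ω, S = {v : EuclideanSpace ℝ (Fin 3) | x + v ∈ ω ∧ ‖v‖ ≤ R}}) →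
      (∀ x ∈ ω, HasSum (fun y : {y : EuclideanSpace ℝ (Fin 3) // y ∈ ω ∧ y ≠ x} =>
        (deriv lennardJones (dist x (y : EuclideanSpace ℝ (Fin 3))) /
          dist x (y : EuclideanSpace ℝ (Fin 3))) • (x - (y : EuclideanSpace ℝ (Fin 3)))) 0) →
      (∀ x ∈ ω', ∀ y ∈ ω', x ≠ y → δ ≤ dist x y) →
      (∀ c : EuclideanSpace ℝ (Fin 3), ∃ y ∈ ω', dist y c ≤ r) →
      (∀ R : ℝ, Set.Finite {S : Set (EuclideanSpace ℝ (Fin 3)) |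
        ∃ x ∈ ω', S = {v : EuclideanSpace ℝ (Fin 3) | x + v ∈ ω' ∧ ‖v‖ ≤ R}}) →
      (∀ x ∈ ω', HasSum (fun y : {y : EuclideanSpace ℝ (Fin 3) // y ∈ ω' ∧ y ≠ x} =>
        (deriv lennardJones (dist x (y : EuclideanSpace ℝ (Fin 3))) /
          dist x (y : EuclideanSpace ℝ (Fin 3))) • (x - (y : EuclideanSpace ℝ (Fin 3)))) 0) →
      ∀ (u : EuclideanSpace ℝ (Fin 3)) (a : ℝ), u ≠ 0 →
        (∀ z : EuclideanSpace ℝ (Fin 3), inner ℝ z u < a → (z ∈ ω ↔ z ∈ ω')) → ω = ω') := by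
  constructor
  · intro hUC Λ δ r hδ hr hsep hden hFLC hbal ω ω' hω hω' _ _ _ _ _ _ _ _ u a hu hagree
    exact hUC Λ δ r hδ hr hsep hden hFLC hbal ω ω' hω hω' u a hu hagree
  · intro h Λ δ r hδ hr hsep hden hFLC hbal ω ω' hω hω' u a hu hagree
    exact h Λ δ r hδ hr hsep hden hFLC hbal ω ω' hω hω'
      (hbl_hull_separated hsep hω) (hbl_hull_dense hden hω) (hbl_hull_flc hFLC hω)
      (hbl_hull_balanced hδ hsep hbal hω)
      (hbl_hull_separated hsep hω') (hbl_hull_dense hden hω') (hbl_hull_flc hFLC hω')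
      (hbl_hull_balanced hδ hsep hbal hω') u a hu hagree

end Summit.AtomisticToContinuum.Crystallization.Theorems

end
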